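import Summits.BirchSwinnertonDyer.BirchSwinnertonDyer.Theorems.ManinLocalTwoThreeBoundaryAnnihilator
import Summits.BirchSwinnertonDyer.BirchSwinnertonDyer.Theorems.ManinLocalTwoThreeCuspClasses
import Literature.NumberTheory.EllipticCurves.ModularSymbolsProofs
import HarnessLib

/-!
# Relative Ihara for PARABOLIC classes is a THEOREM (all `p`, `t`, `n ≥ 1`); period cocycles are parabolic

Summit `BirchSwinnertonDyer`, route `ManinLocalTwoThree` (cell bsd-f2-manin), cruxes C2 `ManinOddAtFour`
(stmt-BirchSwinnertonDyer-22967) / C3 `ManinPrimeToThreeAtNine` (stmt-BirchSwinnertonDyer-22968).  The leaf E-es-25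
`RelativeIharaShiftVanishingBar p t n` quantifies over ALL generalised eigen-cocycles `u ∈ Hom(Γ₀(L), K)`; its proof
(`relativeIharaShiftVanishingBar_of_parabolic`, p3) needs PARABOLICITY of non-Eisenstein generalised eigenclasses (the
`∂`-twin of E-es-30, being landed by p2).  But the cocycles the CRUX CONSUMERS feed into the leaf — the period functionals
`u_φ(γ) = φ({∞, γ∞}_f)` of `Theorems/ManinLocalTwoThreeGenerationOfRelativeIhara{,Two}.lean` — are parabolic BY CONSTRUCTION
(planner es g12, 03:43Z: «periods of a cusp form vanish on every cusp-stabiliser»).  This file records both facts: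

* **`relativeIhara_eq_zero_of_parabolic`** — the INSTANCE form of E-es-25 with a parabolic binder, PROVED for every prime `t`,
  `n ≥ 1`, every field `K` (char `p`), `S ⊇ primes(ptL)`, `λ̄` non-Eisenstein: a parabolic, `tⁿ`-shift-invariant generalised
  `λ`-eigen cocycle on `Γ₀(L)` is `0` (LIFT p602719 + (BND) p603585 + CORE p601365 + END p599806);
* **`cuspSymbol_eq_zero_of_smul_eq`** — the Manin period `{∞, γ∞}_f` vanishes for every `γ ∈ Γ₀(N)` fixing a point of
  `P¹(ℚ)` (at `∞`: `c = 0`; at `r ∈ ℚ`: the tree's Manin relation `modularSymbol_gamma0_smul_holds` with `γ r = r`).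

Consequence (next file): E-es-19 `ShiftClassGenerationThree` follows from the DDT fact
`not_isEisensteinEigensystem_of_hasIrreducibleModPGaloisRep` ALONE, and E-es-22 `MultiShiftClassGenerationTwo` from the
`C₃`-image residual alone — no relative-Ihara leaf, no `∂`-parabolicity input.  Nothing about BSD or Manin's conjecture
is proved here.  References: HOME/MEMO-es.md §22.2, §23, §25 (cell bsd-f2-manin); Ju. I. Manin, Izv. 36 (1972) Prop. 1.4.
-/

set_option autoImplicit false
set_option linter.dupNamespace false

open scoped MatrixGroups ModularForm

open CongruenceSubgroup Matrix.SpecialLinearGroup Literature.NumberTheory.EllipticCurves.ModularForms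
  Literature.NumberTheory.EllipticCurves.ModularForms.HidaCohomology
  Summit.BirchSwinnertonDyer.Rank1Residual.ManinAdditive

namespace Summit.BirchSwinnertonDyer.BirchSwinnertonDyer.Theorems.ManinLocalTwoThree

noncomputable section

/-! ### §1  The parabolic relative Ihara vanishing, per instance -/

/-- **Relative Ihara for parabolic classes (E-es-25 with a parabolic binder), PROVED.**  `t` prime, `n ≥ 1`, `K` a field of
characteristic `p`, `L ≥ 1`, `S ⊇ primes(p t L)`, `λ̄` NOT Eisenstein over `K̄`; a generalised `λ`-eigen cocycle
`u ∈ Hom(Γ₀(L), K)` which is PARABOLIC (kills every `γ` fixing a point of `P¹(ℚ)`) and `tⁿ`-shift-invariant is `0`.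
[folklore] -/
theorem relativeIhara_eq_zero_of_parabolic {p t n : ℕ} (ht : t.Prime) (hn : 1 ≤ n)
    (K : Type) [Field K] [CharP K p] (L : ℕ) [NeZero L] [NeZero t] (S : Finset ℕ) (lam : ℕ → K) (u : cocycles 0 L K)
    (hS : ∀ q : ℕ, q.Prime → q ∣ p * t * L → q ∈ S) (hu : IsHeckeGenEigenvector S lam u)
    (hne : ¬ IsEisensteinEigensystem 2 (fun ℓ => algebraMap K (AlgebraicClosure K) (lam ℓ)))
    (hpar : ∀ γ : Gamma0 L, ∀ c : OnePoint ℚ, mapGL ℚ (γ : SL(2, ℤ)) • c = c → (u : Gamma0 L → Fin 1 → K) γ 0 = 0)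
    (hshift : degeneracyPullback 0 L (L * t ^ n) (t ^ n) K dvd_rfl (u : Gamma0 L → Fin 1 → K) =
      degeneracyPullback 0 L (L * t ^ n) 1 K (by simp) (u : Gamma0 L → Fin 1 → K)) :
    u = 0 := by
  classical
  -- the shift matrix `A = diag(tⁿ, 1)`
  have hdet : (!![((t ^ n : ℕ) : ℚ), 0; 0, 1] : Matrix (Fin 2) (Fin 2) ℚ).det ≠ 0 := by
    rw [Matrix.det_fin_two_of]
    simp [NeZero.ne t]
  let A : GL (Fin 2) ℚ := Matrix.GeneralLinearGroup.mkOfDetNeZero _ hdet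
  have hA : (A : Matrix (Fin 2) (Fin 2) ℚ) = !![((t ^ n : ℕ) : ℚ), 0; 0, 1] := rfl
  have hA' : (A : Matrix (Fin 2) (Fin 2) ℚ) = !![((t : ℚ) ^ n), 0; 0, 1] := by rw [hA, Nat.cast_pow]
  haveI : NeZero (t ^ n) := ⟨pow_ne_zero n (NeZero.ne t)⟩
  -- LIFT (with (BND) from E-es-30) and CORE
  obtain ⟨Φ, hsym, hinv, hAinv, hδ⟩ := exists_shift_invariant_lift_of_boundaryKilled (L := L) (L' := L * t ^ n)
    (d := t ^ n) dvd_rfl (by simp) A hA lam u hu hpar hshift (boundaryKilled_of_prime ht n K L S lam hS hne)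
  haveI : NeZero (L / t ^ (L.factorization t)) := ⟨(Nat.ordCompl_pos t (NeZero.ne L)).ne'⟩
  obtain ⟨χ, hχ, hdiam⟩ := exists_diamondFun_of_invariant_of_shift_invariant_of_eq A hA'
    (Nat.ordProj_mul_ordCompl_eq_self L t) ht hn (Nat.not_dvd_ordCompl ht (NeZero.ne L)) Φ hsym hinv hAinv
  -- END: diamond ⟹ zero
  exact eq_zero_of_coe_eq_diamondFun (Nat.ordCompl_dvd L t) S (fun q hq hqL => hS q hq (dvd_mul_of_dvd_right hqL _))
    lam u hu hne χ hχ (by rw [← hδ, hdiam])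

/-! ### §2  Period cocycles are parabolic -/

section Periods

variable {N : ℕ} [NeZero N] (f : CuspForm (Gamma0 N) 2)

/-- **The Manin period `{∞, γ∞}_f` vanishes on every cusp-fixing `γ ∈ Γ₀(N)`.**  At the cusp `∞` the fixer has `c = 0` and
the period is `0` by definition; at a rational cusp `r` with `γ r = r` the Manin relation `{∞, γ r} = {∞, γ∞} + {∞, r}`
(`modularSymbol_gamma0_smul_holds`) gives `{∞, γ∞} = 0`. [folklore] -/
theorem cuspSymbol_eq_zero_of_smul_eq (γ : Gamma0 N) {c : OnePoint ℚ} (hc : mapGL ℚ (γ : SL(2, ℤ)) • c = c) :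
    cuspSymbol f γ = 0 := by
  cases c with
  | infty =>
    have h10 : (γ : SL(2, ℤ)) 1 0 = 0 := (mapGL_smul_infty_eq_self_iff _).1 hc
    rw [cuspSymbol, if_pos h10]
  | coe r =>
    rw [OnePoint.smul_some_eq_ite] at hc
    have e10 : ((mapGL ℚ (γ : SL(2, ℤ)) : GL (Fin 2) ℚ) : Matrix (Fin 2) (Fin 2) ℚ) 1 0 = (((γ : SL(2, ℤ)) 1 0 : ℤ) : ℚ) := rfl
    have e11 : ((mapGL ℚ (γ : SL(2, ℤ)) : GL (Fin 2) ℚ) : Matrix (Fin 2) (Fin 2) ℚ) 1 1 = (((γ : SL(2, ℤ)) 1 1 : ℤ) : ℚ) := rfl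
    have e00 : ((mapGL ℚ (γ : SL(2, ℤ)) : GL (Fin 2) ℚ) : Matrix (Fin 2) (Fin 2) ℚ) 0 0 = (((γ : SL(2, ℤ)) 0 0 : ℤ) : ℚ) := rfl
    have e01 : ((mapGL ℚ (γ : SL(2, ℤ)) : GL (Fin 2) ℚ) : Matrix (Fin 2) (Fin 2) ℚ) 0 1 = (((γ : SL(2, ℤ)) 0 1 : ℤ) : ℚ) := rfl
    by_cases hden : (((γ : SL(2, ℤ)) 1 0 : ℤ) : ℚ) * r + (((γ : SL(2, ℤ)) 1 1 : ℤ) : ℚ) = 0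
    · -- then `γ r = ∞ ≠ r`
      rw [e10, e11, if_pos hden] at hc
      exact absurd hc (OnePoint.infty_ne_coe r)
    · rw [e10, e11, if_neg hden, e00, e01] at hc
      have hc' : ((((γ : SL(2, ℤ)) 0 0 : ℤ) : ℚ) * r + (((γ : SL(2, ℤ)) 0 1 : ℤ) : ℚ)) /
          ((((γ : SL(2, ℤ)) 1 0 : ℤ) : ℚ) * r + (((γ : SL(2, ℤ)) 1 1 : ℤ) : ℚ)) = r := OnePoint.coe_injective hc
      have key := modularSymbol_gamma0_smul_holds f γ r hden
      rw [hc'] at key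
      -- `{∞, r} = {∞, γ∞} + {∞, r}`
      have := congrArg (fun z => z - modularSymbol f r) key
      simpa using this.symm

/-- **Period functionals give PARABOLIC cochains**: for any additive `φ` on the period lattice, the cochain
`γ ↦ φ({∞, γ∞}_f)` kills every cusp-fixing `γ ∈ Γ₀(N)`. [folklore] -/
theorem periodFunctional_parabolic {R : Type*} [AddCommGroup R] (φ : ↥(periodLattice f) →+ R) (γ : Gamma0 N)
    {c : OnePoint ℚ} (hc : mapGL ℚ (γ : SL(2, ℤ)) • c = c) :
    φ ⟨cuspSymbol f γ, cuspSymbol_mem_periodLattice f γ⟩ = 0 := by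
  have h0 : (⟨cuspSymbol f γ, cuspSymbol_mem_periodLattice f γ⟩ : ↥(periodLattice f)) = 0 :=
    Subtype.ext (cuspSymbol_eq_zero_of_smul_eq f γ hc)
  rw [h0, map_zero]

end Periods

end

end Summit.BirchSwinnertonDyer.BirchSwinnertonDyer.Theorems.ManinLocalTwoThree
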